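import Literature.MathematicalPhysics.QuantumFieldTheory.Balaban1983to89.B9Eq326LocalPartBlockDecay
import Literature.MathematicalPhysics.QuantumFieldTheory.Balaban1983to89.B9Eq349BondBlockDecayFromCircle
import Literature.MathematicalPhysics.QuantumFieldTheory.Balaban1983to89.B9Eq349ConjugatedQLettersCompanion

/-!
# `Balaban1983to89.B9Eq326LocalPartBlockDecayClosed` — T. Bałaban, *Propagators for lattice gauge theories in a background field*, Commun. Math. Phys.
# **99** (1985) 389–434 [Balaban1985BackgroundPropagators] (3.26) p. 395, Thm 3.11 p. 416 *«… the kernels … decay exponentially»*, (3.49) p. 399, (3.15)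
# p. 393, (3.69) p. 404, with [Balaban1985Variational] (134)–(136) p. 298: **THE `L²` BLOCK DECAY OF THE INVERSE OF THE LOCAL PART, CLOSED FORM —
# `‖P_{y₁} ∘ A₀⁻¹ ∘ P_{y₀}‖ ≤ (4∕γ)·e^{r}·e^{−r·d_m(y₀,y₁)}` for `A₀ = Δ(U) + D_UD*_U + Q(U)†(a•Q(U))` AT PRINT's ONE-STEP VECTOR AVERAGING
# `Q(U) := QtorusW`, GIVEN ONLY THE `γ`-COERCIVITY OF `A₀` (Thm 3.11 currency) AND RADIUS WINDOWS IN CLOSED FORM** — the (D0-d) END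
# `B9Eq326LocalPartBlockDecay` of the NE9 owner's plan v11 with its displayed `Q` ∕ `Δ′` ∕ `p_K` ∕ `β_K` letters DISCHARGED by gen 93's
# `B9Eq349ConjugatedQLetters` ∕ `B9Eq369CurvFormConjugation` ∕ g92's `B9Eq369CurvFormL2` through gen 94's companion adapter
# `B9Eq349ConjugatedQLettersCompanion` and ne9-leaf-03's companion read-out `B9Eq349BondBlockDecayFromCircle`

statement-level skeleton of published theorems with citation tags; proofs where landed; nothing here is a claim about the Yang–Mills mass gap

CITATION HEADER (lean-in-tree rule).  Audit cell `pub-balaban`, sub-cell `t4`, BINDER row NE9; filed by the NE9 BINDER-row OWNER lineage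
`b2b-balaban-t4-ne9-p1` (gen 94).  Imports this lineage's (D0-d) `B9Eq326LocalPartBlockDecay` (§1 `norm_conjLocalInv_le_of_circle`: the conjugated inverse
on the circle, letters displayed AT each `κ`), ne9-leaf-03's `B9Eq349BondBlockDecayFromCircle` (`norm_bondBlock_le_exp_of_uniform_circle_bound`: block decay
fine bonds → fine bonds from a circle letter uniform over fine weights with bond increments `≤ ι` AND one-block coarse companions — proof text = (D0-d) §2 with
the companion threaded, their CREDIT line), and gen 94's `B9Eq349ConjugatedQLettersCompanion` (`exists_expConj_Q_letters`, `norm_expConj_curvOp_sub_le`: the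
`Q(U)` and `Δ′(U)` conjugation letters in that companion shape); through them `B9Eq369CurvFormL2.re_inner_curvOp_self_ge` (the `p_K` floor), road B8″'s
`B9Eq387IMSLocalLettersLattice.exists_pointwise_clm` (multiplier CLMs), `B9Eq315QTorus.QtorusW` (print's (3.15)).  Sources READ first-hand
(`paper:balaban1985-cmp99-background-propagators`, journal page = PDF page + 388): p. 395 (3.26), p. 416 Thm 3.11, p. 399 (3.49), p. 393 (3.15), p. 404
(3.69); [Balaban1985Variational] p. 298 (134)–(136).  Print's road to the decay is the random walk of Sect. C with local gauge fixing; the conjugation is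
the ROUTE's Combes–Thomas substitute (road B8″); the rate `r` below is whatever the CLOSED windows allow — a number of the cell, not print's `δ₀`.

WHAT IS PROVED (sorry-free; proof lane — no `def`; [folklore] composition BY NAME).  Data: the one-step torus `T_{(L·m)} → T_m` at the diagonal `ηL = 1`
(`1 ≤ m_i`, `1 ≤ L`); a normed `*`-algebra `𝔸` with fibre `W ≃ 𝔸` (`φ`, `M_φ`, `M_φ′`, `‖X*‖ ≤ ‖X‖`), weights `c₀` (fine), `c₁` (coarse); a background `U`
with `U(b) ∈ U1` (unit balls), mutually adjoint transporters `hRS`, the (3.35)-type letters `hα1 hU1 hreg` of `QtorusW` and their flat twins, `‖U(b) − 1‖ ≤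
ε_U`, plaquette smallness `‖Re U(∂p) − 1‖, ‖Im U(∂p)‖ ≤ δ`; a trace datum `‖τ(XY)‖ ≤ M_τ‖X‖‖Y‖`; `a ≥ 0`; `A₀ = hessOp φ η U τ + D_U∘D*_U + Q†∘(a•Q)` at
`Q := QtorusW L m hL φ U hα1 hU1 hreg` with a positivity witness `hpos₀` (dischargeable from Thm 3.11's `hpos` by `B9Eq326WoodburySchur.local_pos_of_pos`),
`A₀⁻¹ := greenK A₀ hpos₀`.  THE ONE DISPLAYED ESTIMATE: `γ‖f‖² ≤ re⟪f, A₀f⟫` (Thm 3.11 via `B9Eq326WoodburySchur.local_coercive_of_coercive`).  CLOSED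
WINDOWS on the radius `r ≥ 0` and the bookkeeping number `β ≥ 0`: `rη ≤ 1`, `4r ≤ 1`, `4rM_φM_φ′·d√d ≤ β`, `4rM_φM_φ′·d ≤ β`, `2rM_φM_φ′·√d ≤ β`,
`8r·M_φ′M_φ·√(2(c₁∕c₀)(2d(102(d+1)²Lε_U)² + (L^d)⁻¹)) ≤ β`, `p_K∕2 + 3(2+a)β² + 8rη·p_K ≤ γ∕4` with `p_K = 768·|DirPair d|·M_τ·M_φ²·(‖η^d‖∕c₀)·‖η⁻¹‖²·δ`.
* §1 **`norm_block_localInv_le_closed`** — for every bond-block family `P_y` (`π(b) = blockCoord(b₋)`) and every pair of coarse sites,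
  `‖P_{y₁} ∘ A₀⁻¹ ∘ P_{y₀}‖ ≤ (4∕γ)·e^{r}·e^{−r·d_m(y₀,y₁)}`.
HOW.  leaf-03's read-out hands a fine weight `χ` (increments `≤ η = 1∕L`) with a one-block companion `χ′` (`ℓ′ = 1`) and the bond multiplier `M_B`; the
plaquette ∕ site ∕ coarse-bond multipliers `M_P, M_S, M_F` exist by `exists_pointwise_clm`; (D0-d) §1 at `ℓ := 1` takes the `Q`-letters from
`exists_expConj_Q_letters` (two-block constant `3ℓ′ + Lη = 4`, window `4r ≤ 1`), the `Δ′`-letter from `norm_expConj_curvOp_sub_le` (`β_K = 8rη·p_K`) and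
the floor from `re_inner_curvOp_self_ge`.
HONEST SCOPE.  Composition; `γ` displayed (Thm 3.11 currency) together with `hpos₀`; the MODEL letters displayed; ONE step (`ηL = 1`); crude constants;
nothing of [B9] Thm 3.1∕3.3∕3.11 asserted, valued or discharged; «NE9 ⇐ the named binders»; NE9 NOT PRINTED ∕ NOT PROVED; row WALLED ON A MODEL (O-NE9-1;
#5 UNRULED); spine PROVED 0∕9; rung (B)+1 on a finite T⁴ — NOT infinite volume, NOT mass gap, NOT BetaPertH, NOT Clay.  HONEST DEPENDENCY: continuum YM on
T⁴ ⇐ BetaPertH ∧ nine spine estimates (0/9 proved); BetaPertH ⇐ (D1) ∧ (D4) ∧ CAP+tail.  NEW file; nothing modified.  Net new unproved facts: 0.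
-/

noncomputable section

set_option autoImplicit false

open scoped InnerProductSpace ComplexConjugate BigOperators
open NormedSpace

namespace Literature.MathematicalPhysics.QuantumFieldTheory.Balaban1983to89.B9Eq326LocalPartBlockDecayClosed

open B4Sect5Torus (TSite tdist)
open B9SectCLatticeCarrier (Bond DirPair bpos btgt)
open B9Eq311L2Pairing (WL2)
open B9Eq319QprimeTorus (fineP blockCoord)
open B7Prop1Explicit (U1 Wcx boxVec)
open B11Eq103H1Complex (SiteL2K BondL2K greenK covDerivL2K covDivL2K)
open B9Eq310DeltaPrime (reHol imHol)
open B9Eq310HessianOperator (adTransportW PlaqL2K curvOp hessOp)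
open B9Eq315QTorus (perCfg cornerSite QtorusW)
open B9Eq326LocalPartBlockDecay (norm_conjLocalInv_le_of_circle)
open B9Eq349BondBlockDecayFromCircle (norm_bondBlock_le_exp_of_uniform_circle_bound)
open B9Eq349ConjugatedQLettersCompanion (exists_expConj_Q_letters norm_expConj_curvOp_sub_le)
open B9Eq369CurvFormL2 (re_inner_curvOp_self_ge)
open B9Eq387IMSLocalLettersLattice (exists_pointwise_clm)

variable {d : ℕ} (L : ℕ) [NeZero L] (m : Fin d → ℕ) [∀ i, NeZero (fineP L m i)]
  {𝔸 : Type*} [NormedRing 𝔸] [StarRing 𝔸] [NormedAlgebra ℂ 𝔸] [StarModule ℂ 𝔸] [NormOneClass 𝔸] [CompleteSpace 𝔸] (hL : 1 ≤ L)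
  {W : Type*} [NormedAddCommGroup W] [InnerProductSpace ℂ W] [FiniteDimensional ℂ W] (φ : W ≃ₗ[ℂ] 𝔸) {Mφ Mφ' : ℝ}
  (hφ : ∀ w, ‖φ w‖ ≤ Mφ * ‖w‖) (hφ' : ∀ X, ‖φ.symm X‖ ≤ Mφ' * ‖X‖) (hMφ : 0 ≤ Mφ) (hMφ' : 0 ≤ Mφ') (hstar : ∀ X : 𝔸, ‖star X‖ ≤ ‖X‖)
  {c₀ c₁ : ℝ} [Fact (0 < c₀)] [Fact (0 < c₁)] {η : ℝ} (hη : 0 < η) (hηL : η * L = 1)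
  (U : Bond d (fineP L m) → 𝔸ˣ) (hU : ∀ b, U b ∈ U1 𝔸)
  (hRS : ∀ (b : Bond d (fineP L m)) (v u : W), ⟪adTransportW φ U b v, u⟫_ℂ = ⟪v, adTransportW φ (fun b => (U b)⁻¹) b u⟫_ℂ)
  {α : ℝ} (hα1 : α ≤ 1 / 64)
  (hU1 : ∀ (x : B7Prop1Explicit.Site d) (k : Fin d), perCfg (fineP L m) U x k ∈ U1 𝔸)
  (hreg : ∀ (y : TSite d m) (k : Fin d) (ρ : Fin d → Fin L),
    ‖((Wcx L (perCfg (fineP L m) U) (cornerSite L y) k (boxVec L ρ) : 𝔸ˣ) : 𝔸) - 1‖ ≤ α)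
  {α' : ℝ} (hα1' : α' ≤ 1 / 64)
  (hU1' : ∀ (x : B7Prop1Explicit.Site d) (k : Fin d), perCfg (fineP L m) (fun _ : Bond d (fineP L m) => (1 : 𝔸ˣ)) x k ∈ U1 𝔸)
  (hreg' : ∀ (y : TSite d m) (k : Fin d) (ρ : Fin d → Fin L),
    ‖((Wcx L (perCfg (fineP L m) (fun _ : Bond d (fineP L m) => (1 : 𝔸ˣ))) (cornerSite L y) k (boxVec L ρ) : 𝔸ˣ) : 𝔸) - 1‖ ≤ α')
  {εU : ℝ} (hεU : 0 ≤ εU) (hUε : ∀ b : Bond d (fineP L m), ‖(U b : 𝔸) - 1‖ ≤ εU)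
  (τ : 𝔸 →ₗ[ℂ] ℂ) {Mτ : ℝ} (hτ : ∀ X Y : 𝔸, ‖τ (X * Y)‖ ≤ Mτ * ‖X‖ * ‖Y‖) (hMτ : 0 ≤ Mτ)
  {δ : ℝ} (hδ : 0 ≤ δ)
  (hRe : ∀ p : B9SectCLatticeCarrier.Plaq d (fineP L m), ‖reHol U p - 1‖ ≤ δ)
  (hIm : ∀ p : B9SectCLatticeCarrier.Plaq d (fineP L m), ‖imHol U p‖ ≤ δ)
  (a : ℝ)

include hφ hφ' hMφ hMφ' hstar hη hηL hU hRS hα1' hU1' hreg' hεU hUε hτ hMτ hδ hRe hIm in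
/-- **THE `L²` BLOCK DECAY OF `A₀⁻¹`, CLOSED FORM.**  On the one-step torus at the diagonal `ηL = 1`, for the local part
`A₀ = Δ(U) + D_UD*_U + Q(U)†(a•Q(U))` at print's vector averaging `Q(U) := QtorusW`, every background of the model letters, given the `γ`-coercivity of
`A₀` (Thm 3.11 currency, displayed) and the CLOSED radius windows (`rη ≤ 1`, `4r ≤ 1`, `4rM_φM_φ′d√d ≤ β`, `4rM_φM_φ′d ≤ β`, `2rM_φM_φ′√d ≤ β`,
`8r·M_φ′M_φ·√(2(c₁∕c₀)(2d(102(d+1)²Lε_U)² + (L^d)⁻¹)) ≤ β`, `p_K∕2 + 3(2+a)β² + 8rη·p_K ≤ γ∕4`, `p_K = 768·|DirPair d|·M_τ·M_φ²·(‖η^d‖∕c₀)·‖η⁻¹‖²·δ`):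
`‖P_{y₁} ∘ A₀⁻¹ ∘ P_{y₀}‖ ≤ (4∕γ)·e^{r}·e^{−r·d_m(y₀,y₁)}` for every bond-block family and every pair of coarse sites — (D0-d) with its `Q` ∕ `Δ′` ∕ `p_K` ∕
`β_K` letters DISCHARGED. [cite: Balaban1985BackgroundPropagators, (3.26) p.395, Thm 3.11 p.416, (3.49) p.399, (3.15) p.393, (3.69) p.404;
Balaban1985Variational, (134)–(136) p.298] -/
theorem norm_block_localInv_le_closed (ha : 0 ≤ a) (hm : ∀ i, 1 ≤ m i)
    (A₀ : BondL2K ℂ d (fineP L m) c₀ W →ₗ[ℂ] BondL2K ℂ d (fineP L m) c₀ W)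
    (hA₀ : A₀ = hessOp φ η U τ + covDerivL2K ℂ c₀ ((η : ℂ))⁻¹ (adTransportW φ U) ∘ₗ covDivL2K ℂ c₀ ((η : ℂ))⁻¹ (adTransportW φ fun b => (U b)⁻¹) +
      LinearMap.adjoint (QtorusW L m hL φ U hα1 hU1 hreg (c₀ := c₀) (c₁ := c₁)) ∘ₗ
        ((a : ℂ) • QtorusW L m hL φ U hα1 hU1 hreg (c₀ := c₀) (c₁ := c₁)))
    (hpos₀ : ∀ x : BondL2K ℂ d (fineP L m) c₀ W, x ≠ 0 → 0 < RCLike.re ⟪x, A₀ x⟫_ℂ)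
    {γ β r : ℝ} (hγ : 0 < γ) (hβ : 0 ≤ β) (hr : 0 ≤ r)
    (hcoer : ∀ f : BondL2K ℂ d (fineP L m) c₀ W, γ * ‖f‖ ^ 2 ≤ RCLike.re ⟪f, A₀ f⟫_ℂ)
    (hwin : r * η ≤ 1) (hr4 : 4 * r ≤ 1)
    (hβCC : 4 * r * (Mφ * Mφ') * (d * Real.sqrt d) ≤ β) (hβC : 4 * r * (Mφ * Mφ') * d ≤ β) (hβD : 2 * r * (Mφ * Mφ') * Real.sqrt d ≤ β)
    (hβQ : 8 * r * (Mφ' * Mφ * Real.sqrt (2 * (c₁ / c₀) * (2 * d * (102 * (d + 1) ^ 2 * L * εU) ^ 2 + ((L : ℝ) ^ d)⁻¹))) ≤ β)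
    (small : (768 * Fintype.card (DirPair d) * Mτ * Mφ ^ 2 * (‖((η : ℂ)) ^ d‖ / c₀) * ‖((η : ℂ))⁻¹‖ ^ 2 * δ) / 2 + 3 * (2 + a) * β ^ 2 +
      8 * (r * η) * (768 * Fintype.card (DirPair d) * Mτ * Mφ ^ 2 * (‖((η : ℂ)) ^ d‖ / c₀) * ‖((η : ℂ))⁻¹‖ ^ 2 * δ) ≤ γ / 4)
    (PB : TSite d m → BondL2K ℂ d (fineP L m) c₀ W →L[ℂ] BondL2K ℂ d (fineP L m) c₀ W)
    (hPB : ∀ (y : TSite d m) (f : BondL2K ℂ d (fineP L m) c₀ W) (b : Bond d (fineP L m)),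
      WL2.equiv ℂ (fun _ : Bond d (fineP L m) => c₀) W (PB y f) b =
        if blockCoord L m (bpos b) = y then WL2.equiv ℂ (fun _ : Bond d (fineP L m) => c₀) W f b else 0)
    (y₀ y₁ : TSite d m) :
    ‖PB y₁ ∘L LinearMap.toContinuousLinearMap (greenK A₀ hpos₀) ∘L PB y₀‖ ≤ 4 / γ * Real.exp r * Real.exp (-(r * tdist m y₀ y₁)) := by
  have hL0 : (0 : ℝ) < L := by exact_mod_cast (show 0 < L by omega)
  have hLη : (L : ℝ) * η = 1 := by rw [mul_comm]; exact hηL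
  have hι : 1 / (L : ℝ) ≤ η := by rw [div_le_iff₀ hL0, ← hηL]
  -- the `p_K` floor of `Δ′` (g92) and the constant
  set pK : ℝ := 768 * Fintype.card (DirPair d) * Mτ * Mφ ^ 2 * (‖((η : ℂ)) ^ d‖ / c₀) * ‖((η : ℂ))⁻¹‖ ^ 2 * δ with hpK
  have hKre : ∀ f : BondL2K ℂ d (fineP L m) c₀ W, -(pK * ‖f‖ ^ 2) ≤ RCLike.re ⟪f, curvOp φ τ η U f⟫_ℂ :=
    fun f => re_inner_curvOp_self_ge φ hφ hstar τ hτ hMτ η U (fun b => B7Prop1Explicit.mem_U1.mp (hU b)) hδ hRe hIm f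
  refine norm_bondBlock_le_exp_of_uniform_circle_bound L m hm _ hPB hr (by positivity) hι le_rfl
    (fun χ χ' hχ hχ' MB hMB κ hκr => ?_) y₀ y₁
  -- the plaquette, site and coarse-bond multipliers of this weight pair
  obtain ⟨MP, hMP⟩ := exists_pointwise_clm (𝕜 := ℂ) (w := fun _ : B9SectCLatticeCarrier.Plaq d (fineP L m) => c₀) (V := W)
    (fun p : B9SectCLatticeCarrier.Plaq d (fineP L m) => p.1) χ
  obtain ⟨MS, hMS⟩ := exists_pointwise_clm (𝕜 := ℂ) (w := fun _ : TSite d (fineP L m) => c₀) (V := W) (fun x : TSite d (fineP L m) => x) χ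
  obtain ⟨MF, hMF⟩ := exists_pointwise_clm (𝕜 := ℂ) (w := fun _ : Bond d m => c₁) (V := W) (fun c : Bond d m => bpos c) χ'
  -- windows at `ℓ := 1`
  have hχ1 : ∀ b : Bond d (fineP L m), |χ (bpos b) - χ (btgt b)| ≤ 1 * η := fun b => (hχ b).trans (by rw [one_mul])
  have hwin1 : r * 1 * η ≤ 1 := by rw [mul_one]; exact hwin
  have hβCC1 : 4 * r * 1 * (Mφ * Mφ') * (d * Real.sqrt d) ≤ β := by rw [mul_one]; exact hβCC
  have hβC1 : 4 * r * 1 * (Mφ * Mφ') * d ≤ β := by rw [mul_one]; exact hβC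
  have hβD1 : 2 * r * 1 * (Mφ * Mφ') * Real.sqrt d ≤ β := by rw [mul_one]; exact hβD
  refine norm_conjLocalInv_le_of_circle φ hφ hφ' hMφ hMφ' hη U hU hRS τ _ a hMB hMP hMS ha A₀ hA₀ hpos₀ hγ hβ zero_le_one hcoer hKre hχ1 hwin1
    hβCC1 hβC1 hβD1 (fun κ' hκ'r => ⟨?_, fun f => ?_⟩) (βK := 8 * (r * η) * pK) small κ hκr
  · -- the `Q(U)` letters at `κ'` (two-block constant `3·1 + Lη = 4`, window `4r ≤ 1`)
    have hwinQ : ‖κ'‖ * (3 * 1 + L * η) ≤ 1 := by rw [hκ'r, hLη]; linarith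
    obtain ⟨Qk, Qk', h1, h2, h3⟩ := exists_expConj_Q_letters L m hL U hα1 hU1 hreg hα1' hU1' hreg' hεU hUε φ (c₀ := c₀) (c₁ := c₁) hMφ hφ hMφ'
      hφ' hη.le zero_le_one hχ hχ' hMB hMF hwinQ a
    have hcoef : 2 * (‖κ'‖ * (3 * 1 + L * η)) *
        (Mφ' * Mφ * Real.sqrt (2 * (c₁ / c₀) * (2 * d * (102 * (d + 1) ^ 2 * L * εU) ^ 2 + ((L : ℝ) ^ d)⁻¹))) ≤ β := by
      rw [hκ'r, hLη]; linarith
    refine ⟨Qk, Qk', h1, fun f => (h2 f).trans (mul_le_mul_of_nonneg_right hcoef (norm_nonneg _)),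
      fun g => (h3 g).trans (mul_le_mul_of_nonneg_right hcoef (norm_nonneg _))⟩
  · -- the `Δ′(U)` letter at `κ'`
    have hwinK : ‖κ'‖ * η ≤ 1 := by rw [hκ'r]; exact hwin
    have h := norm_expConj_curvOp_sub_le φ hφ hMφ hstar τ hτ hMτ η U hU hδ hRe hIm hη.le hχ hMB hwinK f
    rw [hκ'r] at h
    exact h

end Literature.MathematicalPhysics.QuantumFieldTheory.Balaban1983to89.B9Eq326LocalPartBlockDecayClosed

end
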